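import Mathlib.Topology.Algebra.ContinuousMonoidHom
import Mathlib.Topology.Algebra.OpenSubgroup
import Mathlib.Topology.Algebra.MulAction
import Summits.ABC.IUTFork.ForkBPS
import HarnessLib

/-!
# L-LANA objects I: GM-data, compact structures, étale(-unit) basic prime strips (LANA §3.7, §3.9, §4.1)

Record-only file (D-0012) of the abc-iut cell (seat abc-iut-c312-4, L-LANA level, plan/LLANA-SPEC N1, N4,
N5 (group level), N6 (étale-unit portion)); TAKES NO SIDE on [IUTchIII] Cor. 3.12. It replaces the
INTERFACE `UnitPortion` of `ForkBPS.lean` (XIII: "a type of objects any two of which are isomorphic") by the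
objects Project LANA's interim report actually prints (bib `LANA2026Report`, read on the page, nLab pdf):

* Def. 3.7.1 p. 20 (after [Hoshi, *Introduction to mono-anabelian geometry*, Def. 5.1]): "A triple consisting
  of a topological group `G`, a topological monoid `M`, and a continuous group action `G ↷ M` is called
  GM-data. A morphism between GM-data `G ↷ M` and `G′ ↷ M′` means a pair consisting of a homomorphism of
  topological groups `G → G′` and a homomorphism of topological monoids `M → M′` that gives a morphism of
  actions (cf. §0.4 (c))", §0.4 (c) p. 8: "a pair `ϕ = (ϕ_G, ϕ_X)` … such that the square diagram …
  commutes". "In GM-data `G ↷ M`, the topological group `G` is called its étale-like portion, and `M` is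
  called its Frobenius-like portion." — `GMData`, `GMData.Hom`, `GMData.Iso`.
* Def. 3.9.1 p. 22: "Mono-analytic GM-data equipped with compact structure is therefore a pair which is
  abstractly isomorphic to the pair `(G_v ↷ O^{×μ}_v, {I^κ_H}_H)`. In other words, it is a pair of the form
  `(G ↷ M, {N_H}_H)` where (a) `G ↷ M` is mono-analytic GM-data; (b) `{N_H}_H` is a family of submonoids
  of `M` indexed by open subgroups `H < G` of `G` such that, for some isomorphism between `G ↷ M` and
  `G_v ↷ O^{×μ}_v`, it corresponds to `{I^κ_H}_H`." — `GMDataK` (the pair), `GMDataK.Iso` (Def. 4.1.2 (2):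
  "`ϕ_{M,v}(N_{v,H}) = N′_{v,ϕ_{G,v}(H)}`"), and "abstractly isomorphic to" a REFERENCE datum (§0.4 (e) p. 8:
  "we simply mean that there exists an isomorphism `A ⥲ B` without specifying such an isomorphism").
* Def. 4.1.1/4.1.2 p. 23: étale BPS `{G_v}_{v∈V}` = "`D^⊢`-prime strip … consisting of topological groups
  that are isomorphic to the local Galois group at `v`"; étale-unit BPS = "`F^{⊢×μ}`-prime strip, i.e., a
  collection `{(G_v ↷ M_v, {N_{v,H}}_H)}_{v∈V}` (4-1) … consisting of mono-analytic GM-data with compact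
  structure (§3.9); in other words, it is an object abstractly isomorphic to
  `{(G_v ↷ O^{×μ}_v, {I^κ_H}_H)}_{v∈V}`", with their isomorphisms; "`{G_v}_{v∈V}` is called the étale
  portion … each isomorphism of étale-unit BPSs induces an isomorphism between their étale portions."
  — `EtaleBPS`, `EtaleUnitBPS`, `EtaleUnitBPS.etale`, `EtaleUnitBPS.Iso.etale`.
* PROVED: `EtaleUnitBPS.iso_nonempty` — Lemma 4.1.7's "we always have an isomorphism of the étale-unit
  portions" (p. 24) is a THEOREM about the printed objects (two copies of the reference are isomorphic
  through it) = the field `UnitPortion.conn` XIII had to posit; `LanaBPS` (Def. 4.1.6, BOTH portions as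
  printed), `LanaBPS.isoOfPFEq`/`PF_eq_of_iso` (Lemma 4.1.7 both directions), `isoEquivUnit`.

Modelling notes. (i) "continuous group action `G ↷ M`" on a MONOID is typed as an action by monoid
endomorphisms (`MulDistribMulAction` + `ContinuousSMul`): so in every instance the report considers (Galois
groups on `O^▷_v`, `O^×_v`, `O^{×μ}_v`, §3.6–3.10) and needed by the Kummer map of §6.1 (`M^{gp}[n]` as a
`G`-module; seat abc-iut-L2-t3). (ii) An "isomorphism" is a pair of bi-continuous isomorphisms (`≃ₜ*`)
intertwining the actions. (iii) Carriers are honest types, so these objects live in `Type 1`; XIII's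
`UnitPortion.Obj : Type` cannot host them, and Lemma 4.1.7 / `isoEquivUnit` are re-proved for `LanaBPS` along
XIII's proofs. (iv) The REFERENCE data `G_v ↷ O^{×μ}_v, {I^κ_H}` are a parameter `ref : V → GMDataK`; their
construction from a valued field with Galois action is the sibling `LanaLocalUnits.lean` (LLANA-SPEC N3);
`G_v`, `Π_v` themselves are interfaces of seats abc-iut-L4-t1 / L3-t2. NOT here: holomorphic/mono-analytic
predicates, Table 1 (sibling `LanaStrips.lean`), any judgement.
-/

noncomputable section

namespace Summit.ABC
namespace IUTFork

/-! ## 1. GM-data (Def. 3.7.1) and morphisms of actions (§0.4 (c)) -/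

/-- **LANA Def. 3.7.1 (GM-data).** "A triple consisting of a topological group `G`, a topological monoid
`M`, and a continuous group action `G ↷ M` is called GM-data." (action by monoid endomorphisms: modelling
note (i)). "In GM-data `G ↷ M`, the topological group `G` is called its étale-like portion, and `M` is
called its Frobenius-like portion." [cite: LANA2026Report, Def. 3.7.1 p. 20] -/
structure GMData : Type 1 where
  /-- the étale-like portion: a topological group `G` -/
  G : Type
  /-- the Frobenius-like portion: a topological monoid `M` -/
  M : Type
  [instGroup : Group G]
  [instTopG : TopologicalSpace G]
  [instIsTopGroup : IsTopologicalGroup G]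
  [instMonoid : Monoid M]
  [instTopM : TopologicalSpace M]
  [instContinuousMul : ContinuousMul M]
  [instAction : MulDistribMulAction G M]
  [instContinuousSMul : ContinuousSMul G M]

attribute [instance] GMData.instGroup GMData.instTopG GMData.instIsTopGroup GMData.instMonoid
  GMData.instTopM GMData.instContinuousMul GMData.instAction GMData.instContinuousSMul

namespace GMData

variable {X Y Z : GMData}

/-- **LANA Def. 3.7.1 (morphism of GM-data)**: "a pair consisting of a homomorphism of topological groups
`G → G′` and a homomorphism of topological monoids `M → M′` that gives a morphism of actions (cf. §0.4 (c))",
§0.4 (c): "such that the square diagram … commutes", i.e. `ϕ_M(g·m) = ϕ_G(g)·ϕ_M(m)`.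
[cite: LANA2026Report, Def. 3.7.1 p. 20, §0.4 (c) p. 8] -/
structure Hom (X Y : GMData) where
  /-- `ϕ_G : G → G′`, a continuous homomorphism -/
  toG : X.G →ₜ* Y.G
  /-- `ϕ_M : M → M′`, a continuous homomorphism -/
  toM : X.M →ₜ* Y.M
  /-- the square of §0.4 (c) commutes -/
  map_smul : ∀ (g : X.G) (m : X.M), toM (g • m) = toG g • toM m
/-- Identity morphism. [cite: LANA2026Report, §0.4 (c) p. 8] -/
protected def Hom.id (X : GMData) : Hom X X :=
  ⟨ContinuousMonoidHom.id X.G, ContinuousMonoidHom.id X.M, fun _ _ => rfl⟩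
/-- Composition of morphisms (squares compose). [cite: LANA2026Report, §0.4 (c) p. 8] -/
def Hom.comp (φ : Hom X Y) (ψ : Hom Y Z) : Hom X Z where
  toG := ψ.toG.comp φ.toG
  toM := ψ.toM.comp φ.toM
  map_smul g m := by
    change ψ.toM (φ.toM (g • m)) = ψ.toG (φ.toG g) • ψ.toM (φ.toM m)
    rw [φ.map_smul, ψ.map_smul]

/-- An ISOMORPHISM of GM-data: a pair of bi-continuous isomorphisms `G ⥲ G′`, `M ⥲ M′` making the square of
§0.4 (c) commute (= an invertible morphism, modelling note (ii)). [cite: LANA2026Report, Def. 3.7.1 p. 20] -/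
structure Iso (X Y : GMData) where
  /-- `ϕ_G : G ⥲ G′` -/
  eG : X.G ≃ₜ* Y.G
  /-- `ϕ_M : M ⥲ M′` -/
  eM : X.M ≃ₜ* Y.M
  /-- the square of §0.4 (c) commutes -/
  map_smul : ∀ (g : X.G) (m : X.M), eM (g • m) = eG g • eM m

namespace Iso
/-- The morphism underlying an isomorphism. [cite: LANA2026Report, Def. 3.7.1 p. 20] -/
def toHom (φ : Iso X Y) : Hom X Y := ⟨φ.eG, φ.eM, φ.map_smul⟩
/-- Identity isomorphism. [folklore] -/
protected def refl (X : GMData) : Iso X X :=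
  ⟨ContinuousMulEquiv.refl X.G, ContinuousMulEquiv.refl X.M, fun _ _ => rfl⟩
/-- Inverse isomorphism (the inverse pair is again equivariant). [folklore] -/
protected def symm (φ : Iso X Y) : Iso Y X where
  eG := φ.eG.symm
  eM := φ.eM.symm
  map_smul h n := by
    apply φ.eM.injective
    rw [ContinuousMulEquiv.apply_symm_apply, φ.map_smul, ContinuousMulEquiv.apply_symm_apply,
      ContinuousMulEquiv.apply_symm_apply]
/-- Composite isomorphism. [folklore] -/
protected def trans (φ : Iso X Y) (ψ : Iso Y Z) : Iso X Z where
  eG := φ.eG.trans ψ.eG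
  eM := φ.eM.trans ψ.eM
  map_smul g m := by
    rw [ContinuousMulEquiv.trans_apply, ContinuousMulEquiv.trans_apply, ContinuousMulEquiv.trans_apply,
      φ.map_smul, ψ.map_smul]


end Iso

/-- §0.4 (e): "When we say "an object `A` is isomorphic to `B`," we simply mean that there exists an
isomorphism `A ⥲ B` without specifying such an isomorphism." [cite: LANA2026Report, §0.4 (e) p. 8] -/
@[mk_iff] structure IsIsomorphicTo (X Y : GMData) : Prop where
  /-- there is an isomorphism -/
  nonempty : Nonempty (Iso X Y)
/-- "is isomorphic to" is reflexive, [folklore] -/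
theorem IsIsomorphicTo.refl (X : GMData) : IsIsomorphicTo X X := ⟨⟨Iso.refl X⟩⟩
/-- … symmetric, [folklore] -/
theorem IsIsomorphicTo.symm (h : IsIsomorphicTo X Y) : IsIsomorphicTo Y X :=
  h.nonempty.elim fun φ => ⟨⟨φ.symm⟩⟩
/-- … and transitive. [folklore] -/
theorem IsIsomorphicTo.trans (h : IsIsomorphicTo X Y) (h' : IsIsomorphicTo Y Z) : IsIsomorphicTo X Z :=
  h.nonempty.elim fun φ => h'.nonempty.elim fun ψ => ⟨⟨φ.trans ψ⟩⟩

end GMData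

/-! ## 2. Compact structures (Def. 3.9.1) and their isomorphisms (Def. 4.1.2 (2)) -/

/-- The image `ϕ_G(H)` of an open subgroup under a bi-continuous group isomorphism `ϕ_G : G ⥲ G′` (again
an open subgroup: it is the preimage under `ϕ_G⁻¹`), as used in Def. 4.1.2 (2) "`N′_{v,ϕ_{G,v}(H)}`".
[cite: LANA2026Report, Def. 4.1.2 p. 23] -/
def imageOpenSubgroup {G G' : Type} [Group G] [TopologicalSpace G] [Group G'] [TopologicalSpace G']
    (e : G ≃ₜ* G') (H : OpenSubgroup G) : OpenSubgroup G' :=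
  H.comap (e.symm : G' →* G) e.symm.continuous

section image
variable {G G' G'' : Type} [Group G] [TopologicalSpace G] [Group G'] [TopologicalSpace G']
  [Group G''] [TopologicalSpace G'']

/-- membership in `ϕ_G(H)`. [folklore] -/
@[simp] theorem mem_imageOpenSubgroup (e : G ≃ₜ* G') (H : OpenSubgroup G) (x : G') :
    x ∈ imageOpenSubgroup e H ↔ e.symm x ∈ H := Iff.rfl
/-- `id(H) = H`. [folklore] -/
@[simp] theorem imageOpenSubgroup_refl (H : OpenSubgroup G) :
    imageOpenSubgroup (ContinuousMulEquiv.refl G) H = H := by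
  ext; rfl
/-- `(ψ∘ϕ)(H) = ψ(ϕ(H))`. [folklore] -/
theorem imageOpenSubgroup_trans (e : G ≃ₜ* G') (e' : G' ≃ₜ* G'') (H : OpenSubgroup G) :
    imageOpenSubgroup (e.trans e') H = imageOpenSubgroup e' (imageOpenSubgroup e H) := by
  ext; rfl
/-- `ϕ⁻¹(ϕ(H)) = H`. [folklore] -/
@[simp] theorem imageOpenSubgroup_symm_image (e : G ≃ₜ* G') (H : OpenSubgroup G) :
    imageOpenSubgroup e.symm (imageOpenSubgroup e H) = H := by
  ext x
  simp only [mem_imageOpenSubgroup, ContinuousMulEquiv.symm_symm, ContinuousMulEquiv.symm_apply_apply]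
/-- `ϕ(ϕ⁻¹(H′)) = H′`. [folklore] -/
@[simp] theorem imageOpenSubgroup_image_symm (e : G ≃ₜ* G') (H' : OpenSubgroup G') :
    imageOpenSubgroup e (imageOpenSubgroup e.symm H') = H' := by
  ext x
  simp only [mem_imageOpenSubgroup, ContinuousMulEquiv.symm_symm, ContinuousMulEquiv.apply_symm_apply]

end image

/-- **LANA Def. 3.9.1, abstract form: GM-data WITH COMPACT STRUCTURE** — "a pair of the form
`(G ↷ M, {N_H}_H)` where … `{N_H}_H` is a family of submonoids of `M` indexed by open subgroups `H < G` of
`G`"; for the reference datum `G_v ↷ O^{×μ}_v` the family is the `×μ`-Kummer structure "`I^κ_H` … the image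
of `(O^×_v)^H` under `O^×_v ↠ O^{×μ}_v`" (constructed in `LanaLocalUnits.lean`). Condition (b) "for some
isomorphism … it corresponds to `{I^κ_H}_H`" is `GMDataK.IsCopyOf` below. [cite: LANA2026Report, Def. 3.9.1 p. 22] -/
structure GMDataK : Type 1 extends GMData where
  /-- the compact structure `{N_H}_{H < G open}` -/
  N : OpenSubgroup G → Submonoid M

namespace GMDataK

variable {X Y Z : GMDataK}

/-- **LANA Def. 4.1.2 (2) (isomorphisms respecting compact structures)**: isomorphisms
`ϕ_v = (ϕ_{G,v}, ϕ_{M,v})` from `G_v ↷ M_v` to `G′_v ↷ M′_v` (cf. §0.4 (c)) "such that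
`ϕ_{M,v}(N_{v,H}) = N′_{v,ϕ_{G,v}(H)}`." [cite: LANA2026Report, Def. 4.1.2 p. 23] -/
structure Iso (X Y : GMDataK) extends GMData.Iso X.toGMData Y.toGMData where
  /-- `ϕ_M(N_H) = N′_{ϕ_G(H)}` (as subsets of `M′`) -/
  map_N : ∀ H : OpenSubgroup X.G, (eM : X.M → Y.M) '' (X.N H) = Y.N (imageOpenSubgroup eG H)

namespace Iso
/-- Identity. [folklore] -/
protected def refl (X : GMDataK) : Iso X X where
  toIso := GMData.Iso.refl X.toGMData
  map_N H := by
    change (id : X.M → X.M) '' _ = (X.N (imageOpenSubgroup (ContinuousMulEquiv.refl X.G) H) : Set X.M)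
    rw [imageOpenSubgroup_refl, Set.image_id]
/-- Inverse: `ϕ_M⁻¹(N′_{H′}) = N_{ϕ_G⁻¹(H′)}`. [folklore] -/
protected def symm (φ : Iso X Y) : Iso Y X where
  toIso := φ.toIso.symm
  map_N H' := by
    have h := φ.map_N (imageOpenSubgroup φ.eG.symm H')
    rw [imageOpenSubgroup_image_symm] at h
    change (φ.eM.symm : Y.M → X.M) '' _ = (X.N (imageOpenSubgroup φ.eG.symm H') : Set X.M)
    rw [← h, Set.image_image]
    simp only [ContinuousMulEquiv.symm_apply_apply, Set.image_id']
/-- Composite. [folklore] -/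
protected def trans (φ : Iso X Y) (ψ : Iso Y Z) : Iso X Z where
  toIso := φ.toIso.trans ψ.toIso
  map_N H := by
    change (φ.eM.trans ψ.eM : X.M → Z.M) '' _ = (Z.N (imageOpenSubgroup (φ.eG.trans ψ.eG) H) : Set Z.M)
    rw [imageOpenSubgroup_trans, ← ψ.map_N, ← φ.map_N, Set.image_image]
    rfl

end Iso

/-- "abstractly isomorphic to" (§0.4 (e)) for GM-data with compact structure: Def. 3.9.1 (b) "for some
isomorphism between `G ↷ M` and `G_v ↷ O^{×μ}_v`, it corresponds to `{I^κ_H}_H`".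
[cite: LANA2026Report, Def. 3.9.1 p. 22, §0.4 (e) p. 8] -/
@[mk_iff] structure IsCopyOf (R X : GMDataK) : Prop where
  /-- there is an isomorphism to the reference -/
  nonempty : Nonempty (Iso X R)
/-- The reference datum is a copy of itself. [folklore] -/
theorem IsCopyOf.rfl {R : GMDataK} : IsCopyOf R R := ⟨⟨Iso.refl R⟩⟩
/-- Two copies of the same reference datum are isomorphic (through it). [folklore] -/
theorem IsCopyOf.iso_nonempty {R X Y : GMDataK} (hX : IsCopyOf R X) (hY : IsCopyOf R Y) :
    Nonempty (Iso X Y) :=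
  hX.nonempty.elim fun φ => hY.nonempty.elim fun ψ => ⟨φ.trans ψ.symm⟩

end GMDataK

/-! ## 3. Étale BPS and étale-unit BPS (Def. 4.1.1, Def. 4.1.2) over a reference family -/

/-- **LANA Def. 4.1.1 (étale BPS)** relative to reference local Galois groups `ref v` (`v ∈ V`): "(1) An
étale BPS is a `D^⊢`-prime strip, i.e., a collection `{G_v}_{v∈V}` indexed by `v ∈ V` consisting of
topological groups that are isomorphic to the local Galois group at `v`." The reference groups are the
étale-like portions of the reference GM-data (the local Galois groups `G_v`: interface of seat abc-iut-L4-t1).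
[cite: LANA2026Report, Def. 4.1.1 p. 23] -/
structure EtaleBPS {V : Type} (ref : V → GMDataK) : Type 1 where
  /-- the groups `G_v` -/
  G : V → Type
  [instGroup : ∀ v, Group (G v)]
  [instTop : ∀ v, TopologicalSpace (G v)]
  [instIsTopGroup : ∀ v, IsTopologicalGroup (G v)]
  /-- "isomorphic to the local Galois group at `v`" -/
  isCopy : ∀ v, Nonempty (G v ≃ₜ* (ref v).G)

attribute [instance] EtaleBPS.instGroup EtaleBPS.instTop EtaleBPS.instIsTopGroup

/-- **Def. 4.1.1 (2)**: "An isomorphism of étale BPSs from `{G_v}_{v∈V}` to `{G′_v}_{v∈V}` is a collection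
of isomorphisms `G_v ⥲ G′_v` of topological groups." [cite: LANA2026Report, Def. 4.1.1 p. 23] -/
def EtaleBPS.Iso {V : Type} {ref : V → GMDataK} (D D' : EtaleBPS ref) : Type := ∀ v, D.G v ≃ₜ* D'.G v

/-- Any two étale BPSs (over the same reference) are isomorphic. [cite: LANA2026Report, Def. 4.1.1 p. 23] -/
theorem EtaleBPS.iso_nonempty {V : Type} {ref : V → GMDataK} (D D' : EtaleBPS ref) :
    Nonempty (D.Iso D') :=
  ⟨fun v => (D.isCopy v).some.trans (D'.isCopy v).some.symm⟩

/-- **LANA Def. 4.1.2 (étale-unit BPS)** relative to the reference family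
`ref = {(G_v ↷ O^{×μ}_v, {I^κ_H}_H)}_{v∈V}`: "(1) An étale-unit BPS is an `F^{⊢×μ}`-prime strip, i.e., a
collection `{(G_v ↷ M_v, {N_{v,H}}_H)}_{v∈V}` (4-1) indexed by `v ∈ V` consisting of mono-analytic GM-data
with compact structure (§3.9); in other words, it is an object abstractly isomorphic to
`{(G_v ↷ O^{×μ}_v, {I^κ_H}_H)}_{v∈V}`." ("one can reconstruct an étale-unit BPS from an étale BPS by a certain
anabelian reconstruction algorithm" — not typed: LLANA-SPEC N9, seat abc-iut-L4-t1.)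
[cite: LANA2026Report, Def. 4.1.2 p. 23] -/
structure EtaleUnitBPS {V : Type} (ref : V → GMDataK) : Type 1 where
  /-- the local data `(G_v ↷ M_v, {N_{v,H}}_H)` -/
  X : V → GMDataK
  /-- "abstractly isomorphic to" the reference -/
  isCopy : ∀ v, (ref v).IsCopyOf (X v)

namespace EtaleUnitBPS

variable {V : Type} {ref : V → GMDataK} (B B' B'' : EtaleUnitBPS ref)

/-- **Def. 4.1.2 (2)**: "An isomorphism of étale-unit BPSs … is a collection of isomorphisms
`{ϕ_v = (ϕ_{G,v}, ϕ_{M,v})}` from `G_v ↷ M_v` to `G′_v ↷ M′_v` (cf. §0.4 (c)) such that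
`ϕ_{M,v}(N_{v,H}) = N′_{v,ϕ_{G,v}(H)}`." [cite: LANA2026Report, Def. 4.1.2 p. 23] -/
def Iso : Type := ∀ v, GMDataK.Iso (B.X v) (B'.X v)

variable {B B' B''}

/-- Identity, [folklore] -/
protected def Iso.refl (B : EtaleUnitBPS ref) : Iso B B := fun v => GMDataK.Iso.refl (B.X v)
/-- inverse, [folklore] -/
protected def Iso.symm (Φ : Iso B B') : Iso B' B := fun v => (Φ v).symm
/-- composite. [folklore] -/
protected def Iso.trans (Φ : Iso B B') (Ψ : Iso B' B'') : Iso B B'' := fun v => (Φ v).trans (Ψ v)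

variable (ref) in
/-- The reference family itself, as an étale-unit BPS (the standard one inside a Hodge theater, §4.2 (c)
p. 26 "one can construct an étale-unit BPS `B(H)` from the objects that is reconstructed from `H`").
[cite: LANA2026Report, §4.2 (c) p. 26] -/
def std : EtaleUnitBPS ref := ⟨ref, fun _ => GMDataK.IsCopyOf.rfl⟩

variable (B B')

/-- **"we always have an isomorphism of the étale-unit portions"** (proof of Lemma 4.1.7, p. 24) — a
THEOREM about Def. 4.1.2's objects: both are copies of the reference. This is the posited field
`UnitPortion.conn` of `ForkBPS.lean` (XIII), discharged for LANA's own objects.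
[cite: LANA2026Report, Lemma 4.1.7 p. 24] -/
theorem iso_nonempty : Nonempty (Iso B B') :=
  ⟨fun v => Classical.choice ((B.isCopy v).iso_nonempty (B'.isCopy v))⟩

/-- "In the étale-unit BPS (4-1), `{G_v}_{v∈V}` is called the étale portion, which itself forms an étale
BPS." [cite: LANA2026Report, §4.1 (a) p. 23] -/
def etale : EtaleBPS ref where
  G v := (B.X v).G
  isCopy v := (B.isCopy v).nonempty.elim fun φ => ⟨φ.eG⟩

variable {B B'}

/-- "each isomorphism of étale-unit BPSs induces an isomorphism between their étale portions."
[cite: LANA2026Report, §4.1 (a) p. 23] -/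
def Iso.etale (Φ : Iso B B') : B.etale.Iso B'.etale := fun v => (Φ v).eG

end EtaleUnitBPS

/-! ## 4. Def. 4.1.6 with both portions as printed; Lemma 4.1.7; Rem. 8.2.1 -/

/-- **LANA Def. 4.1.6 (1)**: "A basic prime strip (BPS) `B` is a pair `B = (B^{ét-unit}, B^{val})` of an
étale-unit BPS and a value-group BPS" — the étale-unit portion per Def. 4.1.2 (this file), the value-group
portion per Def. 4.1.3 (`ForkBPS.ValueGroupBPS`, XIII). [cite: LANA2026Report, Def. 4.1.6 p. 24] -/
structure LanaBPS {V : Type} (ref : V → GMDataK) [Fintype V] (bad : Finset V) : Type 1 where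
  /-- `B^{ét-unit}` -/
  unit : EtaleUnitBPS ref
  /-- `B^{val}` -/
  val : ValueGroupBPS V bad

namespace LanaBPS

variable {V : Type} {ref : V → GMDataK} [Fintype V] {bad : Finset V} (B B' : LanaBPS ref bad)

/-- **Def. 4.1.6 (2)**: "An isomorphism of BPSs is a pair consisting of an isomorphism of the étale-unit
portions and an isomorphism of the value-group portions." [cite: LANA2026Report, Def. 4.1.6 p. 24] -/
def Iso : Type := EtaleUnitBPS.Iso B.unit B'.unit × ValueGroupBPS.Iso B.val B'.val

/-- **LANA Lemma 4.1.7 for the printed objects, "if"**: BPSs with equal product formula are isomorphic —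
by `EtaleUnitBPS.iso_nonempty` ("we always have an isomorphism of the étale-unit portions") and XIII's
`ValueGroupBPS.isoOfPFEq`; the "only if" is XIII's `ValueGroupBPS.PF_eq_of_iso` applied to the value
component, and the biconditional is literally XIII's `BPS.iso_nonempty_iff` (not restated). This is also
Rem. 8.2.1's "vacuous" link for the printed objects (XIII `BPS.linked_vacuous`).
[cite: LANA2026Report, Lemma 4.1.7 p. 24] -/
def isoOfPFEq (h : B.val.PF = B'.val.PF) : B.Iso B' :=
  (Classical.choice (B.unit.iso_nonempty B'.unit), ValueGroupBPS.isoOfPFEq h)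

/-- Lemma 4.1.7, "only if", for the printed objects: an isomorphism of BPSs forces equal product formulas
(its value-group component does, XIII). [cite: LANA2026Report, Lemma 4.1.7 p. 24] -/
theorem PF_eq_of_iso (Φ : B.Iso B') : B.val.PF = B'.val.PF := ValueGroupBPS.PF_eq_of_iso Φ.2

/-- **Where the freedom of a link sits** (as in XIII `BPS.isoEquivUnit`, now for Def. 4.1.2's objects):
granted `PF(B) = PF(B′)`, BPS-isomorphisms `B ⥲ B′` ↔ isomorphisms of the étale-unit portions, i.e. families
of equivariant pairs `(ϕ_{G,v}, ϕ_{M,v})` respecting compact structures — the home of "(Ind1) … the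
indeterminacy arising from `Aut(G_v)`. (Ind2) … the automorphism group of `O^×_v` as a monoid with
`G_v`-action" (§6 p. 31). [cite: LANA2026Report, §6 p. 31 (Ind1), (Ind2)] -/
def isoEquivUnit (h : B.val.PF = B'.val.PF) : B.Iso B' ≃ EtaleUnitBPS.Iso B.unit B'.unit where
  toFun p := p.1
  invFun u := (u, ValueGroupBPS.isoOfPFEq h)
  left_inv _ := Prod.ext rfl ((ValueGroupBPS.iso_subsingleton B.val B'.val).elim _ _)
  right_inv _ := rfl

end LanaBPS

end IUTFork

end Summit.ABC

end
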